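import Summits.Ventures.PercRepro.C041SkeletonPortRed

/-!
# THEOREM R, the reduction: the pattern of a source is admissible (p6, gen 23)

Setting of `C041SkeletonPort`.  The blue half of the validity dictionary of C-041.md §6 (d), one direction: for a
configuration of the singleton-attachment family (`Sing S`) with the terminals blue-separated, the pattern read off `S`
is ADMISSIBLE for the port problem of `S` (`adm_patternOf`): a port with a blue bare edge (non-switchable) has all its
terminal edges red — a blue one would violate `Sing` — and no port has a blue 1-edge together with a blue 2-edge (it
would blue-join the terminals).  Hence (`valid_patternOf`) the pattern of a `(D,A)` source with a red terminal edge is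
an admissible valid pattern, so `weight (patternOf S) = 3·g(S) − 2` (`weight_patternOf`) by the `Good` dictionaries.
The converse (every admissible valid pattern, with an admissible outside colouring, comes from exactly one source) is
the bijection of the count, the remaining layer (proofs/P6-THEOREM-R-LEAN-PLAN.md §6).
-/

namespace PercRepro

namespace MultiGraph

open Finset PortProblem

variable {V E : Type*} {G : MultiGraph V E}

section Adm

variable [Fintype V] {a b c : V} (hc : ∀ e, ¬ G.Joins e c a ∧ ¬ G.Joins e c b) {S : Config E}

open Classical in
/-- **The pattern of a source is admissible**: under `Sing` and `a ≁_blue b`. -/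
theorem adm_patternOf (hsing : G.Sing a b S) (hab : ¬ G.Conn Sᶜ a b) :
    (G.portOf a b c hc S).Adm (G.patternOf a b c hc S) := by
  refine ⟨fun t hsw => ?_, fun t t' htt' ht ht' => ?_⟩
  · -- a non-switchable port: some blue bare edge `f` at `u`
    have hsw' : ¬ ∀ f, G.Bare a b f → G.EdgeAt f t.1.1 → S f = true := by
      intro h
      have := decide_eq_true_iff.2 h
      change (G.portOf a b c hc S).sw t.1.1 = true at this
      rw [hsw] at this
      exact Bool.noConfusion this
    -- its terminal edge is red, else `Sing` gives a contradiction
    by_contra hblue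
    apply hsw'
    intro f hf hft
    cases h : t.1.2
    · -- the 1-edge
      have hk := t.2.2.1 h
      obtain ⟨e, he⟩ := decide_eq_true_iff.1 hk
      have hteq : t = ⟨(t.1.1, false), t.2.1, fun _ => hk, fun h' => Bool.noConfusion h'⟩ :=
        Subtype.ext (Prod.ext_iff.mpr ⟨rfl, h⟩)
      rw [hteq, patternOf_one hc t.2.1 hk] at hblue
      have hnot := decide_eq_false_iff_not.1 (Bool.eq_false_iff.2 hblue)
      have hSe : S e = false := by
        cases h' : S e
        · rfl
        · exact absurd ⟨e, he, h'⟩ hnot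
      exact hsing t.1.1 ⟨e, Or.inl he, hSe⟩ f hf hft
    · have hk := t.2.2.2 h
      obtain ⟨e, he⟩ := decide_eq_true_iff.1 hk
      have hteq : t = ⟨(t.1.1, true), t.2.1, fun h' => Bool.noConfusion h', fun _ => hk⟩ :=
        Subtype.ext (Prod.ext_iff.mpr ⟨rfl, h⟩)
      rw [hteq, patternOf_two hc t.2.1 hk] at hblue
      have hnot := decide_eq_false_iff_not.1 (Bool.eq_false_iff.2 hblue)
      have hSe : S e = false := by
        cases h' : S e
        · rfl
        · exact absurd ⟨e, he, h'⟩ hnot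
      exact hsing t.1.1 ⟨e, Or.inr he, hSe⟩ f hf hft
  · -- a blue 1-edge and a blue 2-edge at one port would blue-join the terminals
    by_contra hboth
    rw [not_or] at hboth
    obtain ⟨h1, h2⟩ := hboth
    have hk := t.2.2.1 ht
    have hk' := t'.2.2.2 ht'
    obtain ⟨e, he⟩ := decide_eq_true_iff.1 hk
    obtain ⟨e', he'⟩ := decide_eq_true_iff.1 hk'
    have hteq : t = ⟨(t.1.1, false), t.2.1, fun _ => hk, fun h' => Bool.noConfusion h'⟩ :=
      Subtype.ext (Prod.ext_iff.mpr ⟨rfl, ht⟩)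
    have hteq' : t' = ⟨(t'.1.1, true), t'.2.1, fun h' => Bool.noConfusion h', fun _ => hk'⟩ :=
      Subtype.ext (Prod.ext_iff.mpr ⟨rfl, ht'⟩)
    rw [hteq, patternOf_one hc t.2.1 hk] at h1
    rw [hteq', patternOf_two hc t'.2.1 hk'] at h2
    have hnot1 := decide_eq_false_iff_not.1 (Bool.eq_false_iff.2 h1)
    have hnot2 := decide_eq_false_iff_not.1 (Bool.eq_false_iff.2 h2)
    have hSe : S e = false := by
      cases h' : S e
      · rfl
      · exact absurd ⟨e, he, h'⟩ hnot1
    have hSe' : S e' = false := by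
      cases h' : S e'
      · rfl
      · exact absurd ⟨e', he', h'⟩ hnot2
    apply hab
    -- `a — t — b` in blue (`t.1.1 = t'.1.1`)
    have h1' : G.Conn Sᶜ a t.1.1 := Conn.of_openAdj ⟨e, by rw [compl_apply_not, hSe]; rfl, he.symm⟩
    have h2' : G.Conn Sᶜ t'.1.1 b := Conn.of_openAdj ⟨e', by rw [compl_apply_not, hSe']; rfl, he'⟩
    rw [htt'] at h1'
    exact h1'.trans h2'

open Classical in
/-- **The pattern of a `(D,A)` source with a red terminal edge is admissible and valid.** -/
theorem valid_patternOf (hsing : G.Sing a b S) (hca : ¬ G.Conn Sᶜ c a) (hcb : ¬ G.Conn Sᶜ c b)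
    (hab : ¬ G.Conn Sᶜ a b) (hred : G.Conn S c a ∧ G.Conn S c b)
    (habE : ∃ e, G.Joins e a b ∧ S e = true) :
    (G.portOf a b c hc S).Adm (G.patternOf a b c hc S) ∧
      ((G.portOf a b c hc S).X₁ (G.patternOf a b c hc S) ∨
        (G.portOf a b c hc S).X₂ (G.patternOf a b c hc S)) :=
  ⟨adm_patternOf hc hsing hab, (red_iff_X hc (fun h => hca (h ▸ Conn.refl G _ c))
    (fun h => hcb (h ▸ Conn.refl G _ c)) habE).1 hred⟩

open Classical in
/-- **The weight of the pattern is the Good-degree weight of the source**: `3·[Good_a] + 3·[Good_b] − 2`. -/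
theorem weight_patternOf (hsing : G.Sing a b S) (huniq : G.UniqTerm a b) (hca : ¬ G.Conn Sᶜ c a)
    (hcb : ¬ G.Conn Sᶜ c b) (hab : ¬ G.Conn Sᶜ a b) :
    (G.portOf a b c hc S).weight (G.patternOf a b c hc S) =
      (if G.WalkAvoiding S (G.cluster Sᶜ a) c b then 3 else 0) +
        (if G.WalkAvoiding S (G.cluster Sᶜ b) c a then 3 else 0) - 2 := by
  unfold Problem.weight
  rw [if_congr (good_a_iff hc hsing huniq hca hcb hab).symm rfl rfl,
    if_congr (good_b_iff hc hsing huniq hca hcb hab).symm rfl rfl]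

end Adm

end MultiGraph

end PercRepro
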